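import Summits.ResolutionOfSingularities.ResolutionOfSingularities.Theorems.MarkedTransferCampaignW21TopDegreeLe
import Summits.ResolutionOfSingularities.ResolutionOfSingularities.Theorems.MarkedTransferCampaignW21CaseIIIAllExponents
import HarnessLib

/-!
# [OURS · L1 W2.1] The Def. 9.12-shaped order bound «in all three cases» over `HFlat.op` ON EVERY NAMED CLASS of the
# W2.1 vocabulary — assembly (widest class `ExactClass`, `e > 0`; class (D) `TopDegreeLeOrder`, all `e`)

Rung L (rescue) of cell res-hironaka, RESCUE-SEED row L-G2, slot W2.1, seat res-L1-k21 (kill test K2.1). With the three case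
bounds now theorems for every prime `p` — Case (I) on a class (`orderBoundExactPos_holds` res-L1-s21-pv-1 p474444 on the
widest class `ExactClass` = K2.1's `C_*`, `e > 0`; `orderBoundTopDegreeLe_holds` res-L1-s21-pv-1 p475843 on class (D), all
`e`; `orderBoundMinDegreeTop_holds` res-L1-k21 p463892), Case (II) unconditionally (`orderBoundCaseII_holds`, p473059), Case
(III) unconditionally (`orderBoundCaseIIIPos_holds` p479111 / `orderBoundCaseIII_holds` p479420, res-L1-k21) — the slot's
«FOLLOWS-MODULO-<InClass>» statement in the Def. 9.12 shape (`OrderBoundOpOnPos p C` / `OrderBoundOpOn p C`: «we have thus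
defined the operator H♭ in all three cases of Lem.(9.6) … with orders ≥ ord_ξ(ϵ)», p.51 L30–L31, RESTRICTED TO `C`) is
recorded here for the remaining named classes:

* `orderBoundOpOnPos_exactClass_holds : OrderBoundOpOnPos p ExactClass` — the WIDEST slice (`ExactClass ⊇ LucasClass ⊇
  MinDegreeTop`, `e > 0`): on K2.1's empirical class `C_*` the by-case operator never lowers the order;
* `orderBoundOpOn_topDegreeLeOrder_holds : OrderBoundOpOn p TopDegreeLeOrder` — class (D) `|α+pβ+qγ₀| ≤ ord ε`, ALL `e`
  (the v4 all-`e` schema is true on this class: its Case-(I) part needs no Lucas selection).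

(On the Lucas class and on `MinDegreeTop` the corresponding statements are `orderBoundOpInClassPos_holds` (p479111),
`orderBoundOpOnPos_minDegreeTop_holds` (p479111) and `orderBoundOpOn_minDegreeTop_holds` (p479420).) Pure assembly by cases
on the witness `HFlat.Case`; everything is OURS; nothing is a statement of or about the manuscript under adjudication (GAP
row R05: the UNRESTRICTED Case-(I) clause is refuted as printed by R05's witnesses and is not claimed here). AI-produced
formalisation; expert review is stronger than AI review.

## References
* plan/RESCUE-SEED.md §1 L-G2 W2.1; L/res-L1-k21/KILL-TEST-K2.1.md §6, §13 (cell files; OURS).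
* H. Hironaka, ms. 2017-03-23: Def. 9.12 p.51 L30–L32 — scope only, under adjudication. [Hironaka2017]
-/

noncomputable section

set_option linter.dupNamespace false -- mandated namespace of this single-conjunct summit

namespace Summit.ResolutionOfSingularities.ResolutionOfSingularities.Theorems

namespace CampaignW21

open Literature.AlgebraicGeometry.Hironaka2017.S08UnitMonomial
open Literature.AlgebraicGeometry.Hironaka2017.S09LLUED
open Literature.AlgebraicGeometry.Hironaka2017.S09LLUED.TopFrontier
open Literature.AlgebraicGeometry.Resolution

/-- **[OURS · L1 W2.1] by-case assembly, all `e`**: `OrderBoundOn p C`, `OrderBoundCaseII p` and `OrderBoundCaseIII p`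
give the v4 schema `OrderBoundOpOn p C` (cases on the witness `c : HFlat.Case`; pure logic). [folklore] -/
theorem orderBoundOpOn_of (p : ℕ) [Fact p.Prime]
    (C : ∀ {K : Type} [Field K] {n ℓ : ℕ} (p e : ℕ) (ε : MvPowerSeries (Fin n) K),
      StandardExpression p (xs K n) e ℓ ε → Prop)
    (hI : OrderBoundOn p C) (hII : OrderBoundCaseII p) (hIII : OrderBoundCaseIII p) : OrderBoundOpOn p C := by
  intro K _ _ n e ℓ ε S h0 hS c hC
  cases c with
  | I h => exact hI K n e ℓ ε S h0 hS h hC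
  | II h => exact hII K n e ℓ ε S h0 hS h
  | III h => exact hIII K n e ℓ ε S h0 hS h

/-- **[OURS · L1 W2.1] `OrderBoundOpOnPos p ExactClass` HOLDS for every prime `p`** — the Def. 9.12-shaped bound «in all
three cases» on the WIDEST named class (`ExactClass`, K2.1's `C_*`; `e > 0`): Case (I) `orderBoundExactPos_holds`
(res-L1-s21-pv-1), Case (II) `orderBoundCaseII_holds`, Case (III) `orderBoundCaseIIIPos_holds` (res-L1-k21). NOT a
statement of the manuscript. [folklore] -/
theorem orderBoundOpOnPos_exactClass_holds (p : ℕ) [Fact p.Prime] : OrderBoundOpOnPos p ExactClass :=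
  orderBoundOpOnPos_of p ExactClass (orderBoundExactPos_holds p) (orderBoundCaseII_holds p)
    (orderBoundCaseIIIPos_holds p)

/-- **[OURS · L1 W2.1] `OrderBoundOpOn p TopDegreeLeOrder` HOLDS for every prime `p` and EVERY `e`** — the v4 (all-`e`)
Def. 9.12-shaped bound «in all three cases» on class (D) `|α+pβ+qγ₀| ≤ ord ε` (MINED HYPOTHESIS #1, p470654): Case (I)
`orderBoundTopDegreeLe_holds` (res-L1-s21-pv-1, all `e`), Case (II) `orderBoundCaseII_holds`, Case (III)
`orderBoundCaseIII_holds` (res-L1-k21, all `e`). NOT a statement of the manuscript. [folklore] -/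
theorem orderBoundOpOn_topDegreeLeOrder_holds (p : ℕ) [Fact p.Prime] : OrderBoundOpOn p TopDegreeLeOrder :=
  orderBoundOpOn_of p TopDegreeLeOrder (orderBoundTopDegreeLe_holds p) (orderBoundCaseII_holds p)
    (orderBoundCaseIII_holds p)

/-- **[OURS · L1 W2.1] `OrderBoundOpOnPos p TopDegreeLeOrder`** (`e > 0` slice of the previous theorem, for uniform
citation next to the other `…Pos` classes). NOT a statement of the manuscript. [folklore] -/
theorem orderBoundOpOnPos_topDegreeLeOrder_holds (p : ℕ) [Fact p.Prime] : OrderBoundOpOnPos p TopDegreeLeOrder :=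
  orderBoundOpOnPos_of p TopDegreeLeOrder (orderBoundOnPos_of_orderBoundOn p TopDegreeLeOrder (orderBoundTopDegreeLe_holds p))
    (orderBoundCaseII_holds p) (orderBoundCaseIIIPos_holds p)

end CampaignW21

end Summit.ResolutionOfSingularities.ResolutionOfSingularities.Theorems

end
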